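import Mathlib
import Summits.CriticalPhenomena.CardyFormulaZ2.Theses.CardyAnchoredRigidity
import Summits.CriticalPhenomena.CardyFormulaZ2.Theorems.CardyRotToConfR2SymmetryUpgrade.Negative.CurveTransport
import Literature.Probability.RandomPlanarGeometry.ConformalRestrictionProofs
import Literature.Probability.RandomPlanarGeometry.TangentAtSLE6Proofs

/-!
# Route CardyAnchoredRigidity — `AnchoredPullbackAxioms` (item stmt-CriticalPhenomena-12844)

ANCHORING LEMMA, positive half (card P1(iii)/P3): the pullback `P D := (Φ_{D.pt 1})⁻¹_* S(Φ_{D.pt 1} D)`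
of a chordal, similarity covariant, mirror covariant, domain Markov, local (restriction form),
non-tracing chordal family `S` along a target-anchored field of plane homeomorphisms `b ↦ Φ_b`
(similarities conjugate `Φ_{mb+w}` to `Φ_b` up to a similarity; conjugation intertwines `Φ_{b̄}`
and `Φ_b`) has the same six properties. Two hypotheses of the item are not needed: `Φ_b b = b`,
and the inlined representative independence of `stopAt`/`startFrom` on `ℂ` (it is the tree's
theorem `CurveClass.stopAt_mk_holds` / `startFrom_mk_holds`, used through the transport lemmas
`curveClass_stopAt_map` / `curveClass_startFrom_map` / `remainingDomain_map` of
`CardyRotToConfR2SymmetryUpgrade/Negative/CurveTransport.lean`, which this file reuses).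

Proof: transport of structure. `CurveClass.map φ` is a measurable self-embedding of curve space
with inverse `CurveClass.map φ⁻¹`, so image laws, set integrals and a.e. statements transport on
ALL sets (`MeasurableEmbedding.map_apply / restrict_map / lintegral_map / ae_map_iff`); stopping
at the first hitting of a closed set commutes with `φ`; remaining domains, closures, frontiers and
differences are transported by `φ`. The Markov extension of `P` is
`Q' D past := (Φ_b)⁻¹_* Q (Φ_b D) (Φ_b past)`, `b = D.pt 1`; its `domain` clause holds because
the two configurations compared share the target `b`, hence the map `Φ_b`. Elementary; no named
facts.
-/

noncomputable section

namespace Summit.CriticalPhenomena.CardyFormulaZ2.Theorems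

namespace AnchoredPullback

open Set MeasureTheory Filter Topology
open Literature.Probability.RandomPlanarGeometry
open Summit.CriticalPhenomena.CardyFormulaZ2.Theorems.CardyRotToConfR2SymmetryUpgrade.Negative
  (curveClass_stopAt_map curveClass_startFrom_map remainingDomain_map)

/-! ### Curve surgery commutes with plane homeomorphisms -/

/-- `(φ⁻¹)⁻¹' F = φ '' F` for the inverse homeomorphism coerced to `C(ℂ, ℂ)`. [folklore] -/
theorem preimage_coe_symm (φ : ℂ ≃ₜ ℂ) (F : Set ℂ) : (φ.symm : C(ℂ, ℂ)) ⁻¹' F = φ '' F := by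
  rw [ContinuousMap.coe_coe, Homeomorph.preimage_symm]

/-- Stopping at a closed `F` after pulling back along `φ` is pulling back the curve stopped at
`φ '' F` (curve classes; representative independence is `CurveClass.stopAt_mk_holds`). [folklore] -/
theorem stopAt_map_symm (φ : ℂ ≃ₜ ℂ) {F : Set ℂ} (hF : IsClosed F) (c : CurveClass ℂ) :
    CurveClass.stopAt F (CurveClass.map (φ.symm : C(ℂ, ℂ)) c) =
      CurveClass.map (φ.symm : C(ℂ, ℂ)) (CurveClass.stopAt (φ '' F) c) := by
  rw [curveClass_stopAt_map _ hF, preimage_coe_symm]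

/-- Final segment from a closed `F` after pulling back along `φ`. [folklore] -/
theorem startFrom_map_symm (φ : ℂ ≃ₜ ℂ) {F : Set ℂ} (hF : IsClosed F) (c : CurveClass ℂ) :
    CurveClass.startFrom F (CurveClass.map (φ.symm : C(ℂ, ℂ)) c) =
      CurveClass.map (φ.symm : C(ℂ, ℂ)) (CurveClass.startFrom (φ '' F) c) := by
  rw [curveClass_startFrom_map _ hF, preimage_coe_symm]

/-! ### Push-forward along a plane homeomorphism is an automorphism of curve space -/

/-- `φ_* (φ⁻¹_* c) = c`. [folklore] -/
theorem map_map_symm (φ : ℂ ≃ₜ ℂ) (c : CurveClass ℂ) :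
    CurveClass.map (φ : C(ℂ, ℂ)) (CurveClass.map (φ.symm : C(ℂ, ℂ)) c) = c := by
  obtain ⟨γ, rfl⟩ := CurveClass.surjective_mk c
  rw [CurveClass.map_mk, CurveClass.map_mk]
  congr 1
  ext t
  exact φ.apply_symm_apply _

/-- Push-forward of curve classes along a plane homeomorphism is a measurable embedding of curve
space (so image laws are computed on preimages of all sets). [folklore] -/
theorem measurableEmbedding_map (φ : ℂ ≃ₜ ℂ) :
    MeasurableEmbedding (CurveClass.map (φ : C(ℂ, ℂ))) :=
  ChordalFamily.measurableEmbedding_curveClassMap (CurveClass.measurable_map _)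
    (CurveClass.measurable_map _)

/-- Functoriality of image laws under an intertwining relation `φ₂ ∘ α = β ∘ φ₁` of plane
homeomorphisms: `(φ₂⁻¹)_* β_* ν = α_* (φ₁⁻¹)_* ν`. [folklore] -/
theorem map_map_of_intertwine {α β φ₁ φ₂ : ℂ ≃ₜ ℂ} (h : α.trans φ₂ = φ₁.trans β)
    (ν : Measure (CurveClass ℂ)) :
    (ν.map (CurveClass.map (β : C(ℂ, ℂ)))).map (CurveClass.map (φ₂.symm : C(ℂ, ℂ))) =
      (ν.map (CurveClass.map (φ₁.symm : C(ℂ, ℂ)))).map (CurveClass.map (α : C(ℂ, ℂ))) := by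
  have hβ : β.trans φ₂.symm = φ₁.symm.trans α := by
    ext z
    rw [Homeomorph.trans_apply, Homeomorph.trans_apply, Homeomorph.symm_apply_eq]
    have hz := DFunLike.congr_fun h (φ₁.symm z)
    rw [Homeomorph.trans_apply, Homeomorph.trans_apply, Homeomorph.apply_symm_apply] at hz
    exact hz.symm
  rw [Measure.map_map (CurveClass.measurable_map _) (CurveClass.measurable_map _),
    Measure.map_map (CurveClass.measurable_map _) (CurveClass.measurable_map _),
    ← CurveClass.map_homeomorph_trans, ← CurveClass.map_homeomorph_trans, hβ]

/-! ### Transport of domains -/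

/-- A plane homeomorphism transports closures of set differences. [folklore] -/
theorem image_closure_diff (φ : ℂ ≃ₜ ℂ) (A B : Set ℂ) :
    φ '' closure (A \ B) = closure (φ '' A \ φ '' B) := by
  rw [φ.image_closure, image_sdiff φ.injective]

/-! ### The axioms of the pulled-back family, one homeomorphism at a time -/

variable {S : ChordalFamily}

/-- Chordality transports: `φ⁻¹_* S (φ D)` is a probability law on curves in `D̄` from `a` to `b`.
[folklore] -/
theorem isChordal_step (hS : S.IsChordal) (φ : ℂ ≃ₜ ℂ) (D : DobrushinDomain) :
    IsProbabilityMeasure ((S (D.map φ)).map (CurveClass.map (φ.symm : C(ℂ, ℂ)))) ∧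
      ∀ᵐ γ ∂((S (D.map φ)).map (CurveClass.map (φ.symm : C(ℂ, ℂ)))),
        γ.source = D.pt 0 ∧ γ.target = D.pt 1 ∧ γ.range ⊆ closure D.carrier := by
  obtain ⟨hprob, hae⟩ := hS (D.map φ)
  have he := measurableEmbedding_map φ.symm
  refine ⟨Measure.isProbabilityMeasure_map he.measurable.aemeasurable, ?_⟩
  rw [he.ae_map_iff]
  filter_upwards [hae] with γ hγ
  obtain ⟨h0, h1, hr⟩ := hγ
  refine ⟨?_, ?_, ?_⟩
  · rw [CurveClass.source_map, h0, MarkedDomain.pt_map]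
    exact φ.symm_apply_apply _
  · rw [CurveClass.target_map, h1, MarkedDomain.pt_map]
    exact φ.symm_apply_apply _
  · rw [CurveClass.range_map, ContinuousMap.coe_coe]
    refine (image_mono hr).trans ?_
    rw [MarkedDomain.carrier_map, ← φ.image_closure, φ.image_symm, φ.preimage_image]

/-- Locality (restriction form) transports. [folklore] -/
theorem isLocal_step (hS : S.IsLocal) (φ : ℂ ≃ₜ ℂ) {D D' : DobrushinDomain}
    (hsub : D'.carrier ⊆ D.carrier) (h0 : D'.pt 0 = D.pt 0) (h1 : D'.pt 1 = D.pt 1)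
    {T : Set (CurveClass ℂ)} (hT : MeasurableSet T) :
    (S (D'.map φ)).map (CurveClass.map (φ.symm : C(ℂ, ℂ)))
        (CurveClass.stopAt (closure (D.carrier \ D'.carrier)) ⁻¹' T) =
      (S (D.map φ)).map (CurveClass.map (φ.symm : C(ℂ, ℂ)))
        (CurveClass.stopAt (closure (D.carrier \ D'.carrier)) ⁻¹' T) := by
  have he := measurableEmbedding_map φ.symm
  have hst := stopAt_map_symm φ (isClosed_closure (s := D.carrier \ D'.carrier))
  have hpre : CurveClass.map (φ.symm : C(ℂ, ℂ)) ⁻¹'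
      (CurveClass.stopAt (closure (D.carrier \ D'.carrier)) ⁻¹' T) =
        CurveClass.stopAt (closure ((D.map φ).carrier \ (D'.map φ).carrier)) ⁻¹'
          (CurveClass.map (φ.symm : C(ℂ, ℂ)) ⁻¹' T) := by
    ext c
    simp only [mem_preimage, hst, MarkedDomain.carrier_map, image_closure_diff]
  rw [he.map_apply, he.map_apply, hpre]
  exact hS (D.map φ) (D'.map φ) (image_mono hsub)
    (by rw [MarkedDomain.pt_map, MarkedDomain.pt_map, h0])
    (by rw [MarkedDomain.pt_map, MarkedDomain.pt_map, h1]) _ (he.measurable hT)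

/-- Not tracing boundary arcs transports (frontiers are transported, `φ` is injective).
[folklore] -/
theorem nonTracing_step
    (hS : ∀ D : DobrushinDomain, ∀ᵐ γ ∂(S D), ∀ c : Curve ℂ, CurveClass.mk c = γ →
      ∀ s t : unitInterval, s < t → c '' Set.Icc s t ⊆ frontier D.carrier →
        (c '' Set.Icc s t).Subsingleton)
    (φ : ℂ ≃ₜ ℂ) (D : DobrushinDomain) :
    ∀ᵐ γ ∂((S (D.map φ)).map (CurveClass.map (φ.symm : C(ℂ, ℂ)))), ∀ c : Curve ℂ,
      CurveClass.mk c = γ → ∀ s t : unitInterval, s < t → c '' Set.Icc s t ⊆ frontier D.carrier →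
        (c '' Set.Icc s t).Subsingleton := by
  rw [(measurableEmbedding_map φ.symm).ae_map_iff]
  filter_upwards [hS (D.map φ)] with γ hγ c hc s t hst hsub
  have hc' : CurveClass.mk (c.map (φ : C(ℂ, ℂ))) = γ := by
    rw [← CurveClass.map_mk, hc, map_map_symm]
  have himg : (c.map (φ : C(ℂ, ℂ))) '' Set.Icc s t = φ '' (c '' Set.Icc s t) := by
    rw [image_image]
    rfl
  refine subsingleton_of_image φ.injective _ ?_
  have h := hγ _ hc' s t hst (by
    rw [himg, MarkedDomain.carrier_map, ← φ.image_frontier]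
    exact image_mono hsub)
  rwa [himg] at h

/-- The `initial` clause of the transported Markov extension. [folklore] -/
theorem markov_initial_step {Q : DobrushinDomain → CurveClass ℂ → Measure (CurveClass ℂ)}
    (hQ : S.IsMarkovExtension Q) (φ : ℂ ≃ₜ ℂ) (D : DobrushinDomain) :
    (Q (D.map φ) (CurveClass.map (φ : C(ℂ, ℂ)) (CurveClass.mk (Curve.const (D.pt 0))))).map
        (CurveClass.map (φ.symm : C(ℂ, ℂ))) =
      (S (D.map φ)).map (CurveClass.map (φ.symm : C(ℂ, ℂ))) := by
  have h0 : CurveClass.map (φ : C(ℂ, ℂ)) (CurveClass.mk (Curve.const (D.pt 0))) =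
      CurveClass.mk (Curve.const ((D.map φ).pt 0)) := rfl
  rw [h0, hQ.initial]

/-- The `markov` (disintegration) clause of the transported Markov extension. [folklore] -/
theorem markov_markov_step
    {Q : DobrushinDomain → CurveClass ℂ → Measure (CurveClass ℂ)}
    (hQ : S.IsMarkovExtension Q) (φ : ℂ ≃ₜ ℂ) (D : DobrushinDomain) {F : Set ℂ}
    (hF : IsClosed F) {A B : Set (CurveClass ℂ)} (hA : MeasurableSet A) (hB : MeasurableSet B) :
    (S (D.map φ)).map (CurveClass.map (φ.symm : C(ℂ, ℂ)))
        (CurveClass.stopAt F ⁻¹' A ∩ CurveClass.startFrom F ⁻¹' B) =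
      ∫⁻ γ in CurveClass.stopAt F ⁻¹' A,
        (Q (D.map φ) (CurveClass.map (φ : C(ℂ, ℂ)) (γ.stopAt F))).map
          (CurveClass.map (φ.symm : C(ℂ, ℂ))) B
        ∂((S (D.map φ)).map (CurveClass.map (φ.symm : C(ℂ, ℂ)))) := by
  have he := measurableEmbedding_map φ.symm
  have hF' : IsClosed (φ '' F) := φ.isClosed_image.2 hF
  have hst := stopAt_map_symm φ hF
  have hsf := startFrom_map_symm φ hF
  have hpreA : CurveClass.map (φ.symm : C(ℂ, ℂ)) ⁻¹' (CurveClass.stopAt F ⁻¹' A) =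
      CurveClass.stopAt (φ '' F) ⁻¹' (CurveClass.map (φ.symm : C(ℂ, ℂ)) ⁻¹' A) := by
    ext c
    simp only [mem_preimage, hst]
  have hpreB : CurveClass.map (φ.symm : C(ℂ, ℂ)) ⁻¹' (CurveClass.startFrom F ⁻¹' B) =
      CurveClass.startFrom (φ '' F) ⁻¹' (CurveClass.map (φ.symm : C(ℂ, ℂ)) ⁻¹' B) := by
    ext c
    simp only [mem_preimage, hsf]
  rw [he.map_apply, preimage_inter, hpreA, hpreB,
    hQ.markov _ _ hF' _ _ (he.measurable hA) (he.measurable hB), he.restrict_map,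
    he.lintegral_map, hpreA]
  refine lintegral_congr fun γ => ?_
  rw [hst, map_map_symm, he.map_apply]

/-- The `domain` clause of the transported Markov extension: both configurations share the
target, hence the same anchoring map. [folklore] -/
theorem markov_domain_step {Q : DobrushinDomain → CurveClass ℂ → Measure (CurveClass ℂ)}
    (hQ : S.IsMarkovExtension Q) (φ : ℂ ≃ₜ ℂ) {D₁ D₂ : DobrushinDomain} {p₁ p₂ : CurveClass ℂ}
    (hrem : remainingDomain D₁ p₁ = remainingDomain D₂ p₂) (htgt : p₁.target = p₂.target)
    (hpt : D₁.pt 1 = D₂.pt 1) :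
    (Q (D₁.map φ) (CurveClass.map (φ : C(ℂ, ℂ)) p₁)).map (CurveClass.map (φ.symm : C(ℂ, ℂ))) =
      (Q (D₂.map φ) (CurveClass.map (φ : C(ℂ, ℂ)) p₂)).map
        (CurveClass.map (φ.symm : C(ℂ, ℂ))) := by
  rw [hQ.domain (D₁.map φ) (D₂.map φ) _ _ (by rw [remainingDomain_map, remainingDomain_map, hrem])
    (by rw [CurveClass.target_map, CurveClass.target_map, htgt])
    (by rw [MarkedDomain.pt_map, MarkedDomain.pt_map, hpt])]

/-! ### The pulled-back family -/

variable {P : ChordalFamily} {Φ : ℂ → ℂ ≃ₜ ℂ}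
  (hP : ∀ D : DobrushinDomain, P D = (S (D.map (Φ (D.pt 1)))).map
    (CurveClass.map ((Φ (D.pt 1)).symm : C(ℂ, ℂ))))
include hP

/-- The pullback family is chordal. [folklore] -/
theorem pullback_isChordal (hS : S.IsChordal) : P.IsChordal := by
  intro D
  rw [hP D]
  exact isChordal_step hS _ D

/-- The pullback family is similarity covariant (similarities conjugate `Φ_{mb+w}` to `Φ_b` up to
a similarity). [folklore] -/
theorem pullback_isSimilarityCovariant
    (hΦ : ∀ (b m : ℂ) (hm : m ≠ 0) (w : ℂ), ∃ (m' : ℂ) (hm' : m' ≠ 0) (w' : ℂ),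
      (similarity m hm w).trans (Φ (m * b + w)) = (Φ b).trans (similarity m' hm' w'))
    (hS : S.IsSimilarityCovariant) : P.IsSimilarityCovariant := by
  intro D m hm w
  obtain ⟨m', hm', w', hconj⟩ := hΦ (D.pt 1) m hm w
  have hb : (D.map (similarity m hm w)).pt 1 = m * D.pt 1 + w := rfl
  rw [hP (D.map _), hP D, hb, MarkedDomain.map_map, hconj, ← MarkedDomain.map_map, hS]
  exact map_map_of_intertwine hconj _

/-- The pullback family is mirror covariant (conjugation intertwines `Φ_{b̄}` and `Φ_b`).
[folklore] -/
theorem pullback_mirror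
    (hΦ : ∀ b : ℂ, Complex.conjCLE.toHomeomorph.trans (Φ ((starRingEnd ℂ) b)) =
      (Φ b).trans Complex.conjCLE.toHomeomorph)
    (hS : ∀ D : DobrushinDomain, S (D.map Complex.conjCLE.toHomeomorph) =
      (S D).map (CurveClass.map (Complex.conjCLE.toHomeomorph : C(ℂ, ℂ)))) :
    ∀ D : DobrushinDomain, P (D.map Complex.conjCLE.toHomeomorph) =
      (P D).map (CurveClass.map (Complex.conjCLE.toHomeomorph : C(ℂ, ℂ))) := by
  intro D
  have hb : (D.map Complex.conjCLE.toHomeomorph).pt 1 = (starRingEnd ℂ) (D.pt 1) := rfl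
  rw [hP (D.map _), hP D, hb, MarkedDomain.map_map, hΦ, ← MarkedDomain.map_map, hS]
  exact map_map_of_intertwine (hΦ (D.pt 1)) _

/-- The pullback family is domain Markov, with extension
`Q' D past := (Φ_b)⁻¹_* Q (Φ_b D) (Φ_b past)`, `b = D.pt 1`. [folklore] -/
theorem pullback_isDomainMarkov (hS : S.IsDomainMarkov) : P.IsDomainMarkov := by
  obtain ⟨Q, hQ⟩ := hS
  refine ⟨fun D past => (Q (D.map (Φ (D.pt 1))) (CurveClass.map ((Φ (D.pt 1)) : C(ℂ, ℂ)) past)).map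
    (CurveClass.map ((Φ (D.pt 1)).symm : C(ℂ, ℂ))), ?_, ?_, ?_⟩
  · intro D
    rw [hP D]
    exact markov_initial_step hQ _ D
  · intro D F hF A B hA hB
    rw [hP D]
    exact markov_markov_step hQ _ D hF hA hB
  · intro D₁ D₂ p₁ p₂ hrem htgt hpt
    rw [hpt]
    exact markov_domain_step hQ _ hrem htgt hpt

/-- The pullback family is local (restriction form). [folklore] -/
theorem pullback_isLocal (hS : S.IsLocal) : P.IsLocal := by
  intro D D' hsub h0 h1 T hT
  rw [hP D', hP D, h1]
  exact isLocal_step hS _ hsub h0 h1 hT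

/-- The pullback family traces no boundary arc. [folklore] -/
theorem pullback_nonTracing
    (hS : ∀ D : DobrushinDomain, ∀ᵐ γ ∂(S D), ∀ c : Curve ℂ, CurveClass.mk c = γ →
      ∀ s t : unitInterval, s < t → c '' Set.Icc s t ⊆ frontier D.carrier →
        (c '' Set.Icc s t).Subsingleton) :
    ∀ D : DobrushinDomain, ∀ᵐ γ ∂(P D), ∀ c : Curve ℂ, CurveClass.mk c = γ →
      ∀ s t : unitInterval, s < t → c '' Set.Icc s t ⊆ frontier D.carrier →
        (c '' Set.Icc s t).Subsingleton := by
  intro D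
  rw [hP D]
  exact nonTracing_step hS _ D

end AnchoredPullback

open Summit.CriticalPhenomena.CardyFormulaZ2.Theses.CardyAnchoredRigidity in
/-- **AnchoredPullbackAxioms** (route CardyAnchoredRigidity, item stmt-CriticalPhenomena-12844;
Anchoring Lemma, positive half): the pullback `P D := (Φ_{D.pt 1})⁻¹_* S(Φ_{D.pt 1} D)` of a
chordal, similarity covariant, mirror covariant, domain Markov, local, non-tracing chordal family
`S` along a target-anchored field of plane homeomorphisms `Φ` (similarity conjugation and
conjugation intertwining; representative independence of `stopAt`/`startFrom` on `ℂ` inlined)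
is again chordal, similarity covariant, mirror covariant, domain Markov, local and non-tracing.
Transport of structure through the measurable automorphism `CurveClass.map Φ_b` of curve space;
the hypotheses `Φ_b b = b` and representative independence (a theorem of the tree,
`CurveClass.stopAt_mk_holds`) are not used. -/
theorem anchoredPullbackAxioms_proof : AnchoredPullbackAxioms := by
  unfold AnchoredPullbackAxioms
  intro S Φ _hfix hsim hconj _hrep hCh hSimS hMirS hMkS hLocS hNT P hP
  exact ⟨AnchoredPullback.pullback_isChordal hP hCh,
    AnchoredPullback.pullback_isSimilarityCovariant hP hsim hSimS,
    AnchoredPullback.pullback_mirror hP hconj hMirS,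
    AnchoredPullback.pullback_isDomainMarkov hP hMkS,
    AnchoredPullback.pullback_isLocal hP hLocS,
    AnchoredPullback.pullback_nonTracing hP hNT⟩

end Summit.CriticalPhenomena.CardyFormulaZ2.Theorems
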